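import Summits.QuantumFields.BalabanUV.Beta.EriceFlowEnclosureB12AsPrintedHistoryContagionShiftFlowZeroSemigroupGellMannLowIntegral

/-!
# Beta / EriceFlowEnclosureB12AsPrintedHistoryContagionShiftFlowZeroSemigroupGellMannLowSmooth — ASYMPTOTIC FREEDOM IS CONTAGIOUS, part 60: THE SMOOTH THEORY (ABSTRACT) —
# IF the Λ-coordinate is differentiable at EVERY interior coupling (derivative D), THEN the continuous renormalization group is the flow of the autonomous ordinary
# differential equation **`ġ = β_c(g)`, `β_c = β₀∕D`**, at EVERY scale.  Parts 55–59 worked with what the flow with memory supplies unconditionally (a.e.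
# differentiability); this part records the abstract conditional: WHICH hypothesis on the functional B would make Λ differentiable everywhere is typed nowhere (g40
# NEXT-TOUCH (A⁗′) — a node U2 question; the Markov case is P1 #48c `…MarkovLambdaDeriv`), so here D is a HYPOTHESIS FUNCTION with `HasDerivAt Λ (D x) x` on ]0, e′[, over
# an abstract strictly antitone Λ onto `[Λ e′, ∞[` with part 35's chart bounds.  THEN (§96): `D < 0` with `−8∕(3x³) ≤ D ≤ −4∕(3x³)` (`generator_bounds`); THE GELL-MANN–LOW
# ODE AT EVERY SCALE **`∂_s φ_s g = β₀∕D(φ_s g)`** (**`rg_hasDerivAt`**, `rg_deriv_eq`, `rg_differentiableOn`); the pin derivative **`∂_g φ_s g = D(g)∕D(φ_s g)`**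
# (**`rg_hasDerivAt_pin`**) and the LINEAR RG EQUATION `∂_s φ = (β₀∕D(g))·∂_g φ` at every point (`rg_transport_everywhere`); if D is continuous the velocity
# `s ↦ β₀∕D(φ_s g)` is continuous — the running coupling is C¹ in the scale (`rg_velocity_continuousOn`); (§97) **`∫_{g₁}^{g₂} D = Λ g₂ − Λ g₁`** with NO integrability
# hypothesis on D (part 59's absolute continuity; `integral_generator_eq`) and RG TIME **`s = ∫_{φ_s g}^{g} dx∕|β_c(x)|`**, `|β_c| = −β₀∕D` (`rg_time_eq_integral_generator`).
# Part 61 inhabits every hypothesis with the exactly soluble toy `B ≡ 1` (`Λ = 1∕g² − 1∕e′²`, `D = −2∕g³`, `φ_s g = (1∕g² + s)^{−1∕2}`, `β_c(g) = −g³∕2`).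
# Abstract in Λ (β-flow team, prover 1 = recursion ∕ upper ∕ bare-coupling ∕ uniqueness side, unit `b2b-balaban-beta-bflow-p1`, gen 41; ROW AP-I·Uc × NODE U2 — the
# infinitesimal renormalization group, smooth case; over parts 55–56 (`hasDerivAt_abel_bounds`, `hasDerivAt_rg_of_hasDerivAt_abel`, `hasDerivAt_rg_pin`), part 59
# (`abel_integral_deriv`), part 51 (`rg_continuousOn`), part 46 (`rg_mem_eq`, `rg_le_self`))

HONEST FRAMING (page 1 of everything the β sub-cell writes): discharging `BetaPertH` makes Bałaban's UV stability UNCONDITIONAL — a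
real constructive-QFT result; it is NOT the continuum limit and NOT the Clay problem.  HONEST DEPENDENCY (cell reorg 2026-08-19,
verbatim): «continuum YM on T⁴ ⇐ BetaPertH ∧ nine spine estimates (0/9 proved); BetaPertH ⇐ (D1) ∧ (D4) ∧ CAP+tail; G-an2-4 gates
asym, D1 and NE2/3/4.»  THIS MODULE DISCHARGES NOTHING: [folklore] calculus about an ABSTRACT strictly antitone Λ with chart bounds AND an everywhere derivative D — a
HYPOTHESIS inhabited by the toy of part 61 and by nothing typed for the flow with memory (whose Λ is only known to be differentiable a.e., part 55); no hypothesis shape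
of node U2 is touched, nothing restated.  NOTHING is asserted about Bałaban's actual β; «Gell-Mann–Low ODE», «β_c», «linear RG equation» are OUR READING.  [I] = T.
Bałaban, Commun. Math. Phys. **109** (1987) 249–301 [Balaban1987RG1]: Thm 2 (0.31) p. 259 — context of the row only.

WHAT THIS FILE PROVES (0 sorry, 0 def): §96 `generator_bounds`, **`rg_hasDerivAt`**, `rg_deriv_eq`, `rg_differentiableOn`, **`rg_hasDerivAt_pin`**,
**`rg_transport_everywhere`**, `rg_velocity_continuousOn`; §97 **`integral_generator_eq`**, **`rg_time_eq_integral_generator`**.  NOT CLAIMED: that the flow with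
memory satisfies the hypothesis `HasDerivAt Λ (D x) x` everywhere; anything about Bałaban's β; `BetaPertH`; continuum; Clay.
-/

namespace Summit.QuantumFields.BalabanUV.Beta.EriceFlowEnclosureB12AsPrintedHistoryContagionShiftFlowZeroSemigroupGellMannLowSmooth

open Filter Topology Set Function MeasureTheory intervalIntegral
open Summit.QuantumFields.BalabanUV.Beta.EriceFlowEnclosureB12AsPrintedHistoryContagionShiftFlowZeroSemigroup (rg_mem_eq rg_le_self)
open Summit.QuantumFields.BalabanUV.Beta.EriceFlowEnclosureB12AsPrintedHistoryContagionShiftFlowZeroSemigroupOneLoop (rg_continuousOn)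
open Summit.QuantumFields.BalabanUV.Beta.EriceFlowEnclosureB12AsPrintedHistoryContagionShiftFlowZeroSemigroupBackward (rg_mem_eq_of_le)
open Summit.QuantumFields.BalabanUV.Beta.EriceFlowEnclosureB12AsPrintedHistoryContagionShiftFlowZeroSemigroupVelocity (hasDerivAt_abel_bounds)
open Summit.QuantumFields.BalabanUV.Beta.EriceFlowEnclosureB12AsPrintedHistoryContagionShiftFlowZeroSemigroupGellMannLow (hasDerivAt_rg_of_hasDerivAt_abel
  hasDerivAt_rg_pin)
open Summit.QuantumFields.BalabanUV.Beta.EriceFlowEnclosureB12AsPrintedHistoryContagionShiftFlowZeroSemigroupGellMannLowIntegral (abel_integral_deriv)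

noncomputable section

variable {Λ D : ℝ → ℝ} {e' β₀ : ℝ}

/-! ## §96 The Gell-Mann–Low ordinary differential equation at every scale (abstract smooth case) -/

/-- **THE GENERATOR IS NEGATIVE**: if Λ (chart bounds (2∕3, 4∕3)) has derivative `D x` at every interior coupling, then `−8∕(3x³) ≤ D x ≤ −4∕(3x³) < 0` on ]0, e′[ —
so `β_c = β₀∕D < 0`: asymptotic freedom of the infinitesimal generator's SIGN, at every coupling. [folklore] -/
theorem generator_bounds (hbounds : ∀ e₁ ∈ Ioc (0 : ℝ) e', ∀ e₂ ∈ Ioc (0 : ℝ) e', e₁ ≤ e₂ →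
      2 / 3 * (1 / e₁ ^ 2 - 1 / e₂ ^ 2) ≤ Λ e₁ - Λ e₂ ∧ Λ e₁ - Λ e₂ ≤ 4 / 3 * (1 / e₁ ^ 2 - 1 / e₂ ^ 2))
    (hD : ∀ x ∈ Ioo (0 : ℝ) e', HasDerivAt Λ (D x) x) {x : ℝ} (hx : x ∈ Ioo (0 : ℝ) e') :
    -8 / (3 * x ^ 3) ≤ D x ∧ D x ≤ -4 / (3 * x ^ 3) ∧ D x < 0 :=
  hasDerivAt_abel_bounds hbounds hx (hD x hx)

/-- **THE GELL-MANN–LOW ODE AT EVERY SCALE**: Λ strictly antitone on ]0, e′] onto `[Λ e′, ∞[` with the chart bounds, β₀ > 0, and `HasDerivAt Λ (D x) x` at EVERY interior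
coupling; then for every pin g and real scale s with `Λ e′ < Λ g + sβ₀`: **`∂_s φ_s g = β₀∕D(φ_s g)`** — the running coupling solves the autonomous equation `ġ = β_c(g)`,
`β_c := β₀∕D`, at every scale (not just almost every one, part 56). [folklore; Szekeres 1958 (regular iteration groups)] -/
theorem rg_hasDerivAt (hanti : StrictAntiOn Λ (Ioc 0 e')) (honto : ∀ y : ℝ, Λ e' ≤ y → ∃ x ∈ Ioc (0 : ℝ) e', Λ x = y) (hβ₀ : 0 < β₀)
    (hbounds : ∀ e₁ ∈ Ioc (0 : ℝ) e', ∀ e₂ ∈ Ioc (0 : ℝ) e', e₁ ≤ e₂ →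
      2 / 3 * (1 / e₁ ^ 2 - 1 / e₂ ^ 2) ≤ Λ e₁ - Λ e₂ ∧ Λ e₁ - Λ e₂ ≤ 4 / 3 * (1 / e₁ ^ 2 - 1 / e₂ ^ 2))
    (hD : ∀ x ∈ Ioo (0 : ℝ) e', HasDerivAt Λ (D x) x) {g s : ℝ} (hgs : Λ e' < Λ g + s * β₀) :
    HasDerivAt (fun σ : ℝ => invFunOn Λ (Ioc 0 e') (Λ g + σ * β₀)) (β₀ / D (invFunOn Λ (Ioc 0 e') (Λ g + s * β₀))) s := by
  obtain ⟨hxmem, hΛx⟩ := rg_mem_eq_of_le honto hgs.le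
  have hxlt : invFunOn Λ (Ioc 0 e') (Λ g + s * β₀) < e' := by
    rcases hxmem.2.lt_or_eq with h | h
    · exact h
    · exfalso; rw [h] at hΛx; linarith
  exact hasDerivAt_rg_of_hasDerivAt_abel hanti honto hβ₀ hbounds hgs (hD _ ⟨hxmem.1, hxlt⟩)

/-- The velocity as a `deriv`: `deriv (s ↦ φ_s g) s = β₀∕D(φ_s g)`. [folklore] -/
theorem rg_deriv_eq (hanti : StrictAntiOn Λ (Ioc 0 e')) (honto : ∀ y : ℝ, Λ e' ≤ y → ∃ x ∈ Ioc (0 : ℝ) e', Λ x = y) (hβ₀ : 0 < β₀)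
    (hbounds : ∀ e₁ ∈ Ioc (0 : ℝ) e', ∀ e₂ ∈ Ioc (0 : ℝ) e', e₁ ≤ e₂ →
      2 / 3 * (1 / e₁ ^ 2 - 1 / e₂ ^ 2) ≤ Λ e₁ - Λ e₂ ∧ Λ e₁ - Λ e₂ ≤ 4 / 3 * (1 / e₁ ^ 2 - 1 / e₂ ^ 2))
    (hD : ∀ x ∈ Ioo (0 : ℝ) e', HasDerivAt Λ (D x) x) {g s : ℝ} (hgs : Λ e' < Λ g + s * β₀) :
    deriv (fun σ : ℝ => invFunOn Λ (Ioc 0 e') (Λ g + σ * β₀)) s = β₀ / D (invFunOn Λ (Ioc 0 e') (Λ g + s * β₀)) :=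
  (rg_hasDerivAt hanti honto hβ₀ hbounds hD hgs).deriv

/-- For every `g ∈ ]0, e′]` the running coupling is differentiable on all of ]0, ∞[. [folklore] -/
theorem rg_differentiableOn (hanti : StrictAntiOn Λ (Ioc 0 e')) (honto : ∀ y : ℝ, Λ e' ≤ y → ∃ x ∈ Ioc (0 : ℝ) e', Λ x = y) (hβ₀ : 0 < β₀)
    (hbounds : ∀ e₁ ∈ Ioc (0 : ℝ) e', ∀ e₂ ∈ Ioc (0 : ℝ) e', e₁ ≤ e₂ →
      2 / 3 * (1 / e₁ ^ 2 - 1 / e₂ ^ 2) ≤ Λ e₁ - Λ e₂ ∧ Λ e₁ - Λ e₂ ≤ 4 / 3 * (1 / e₁ ^ 2 - 1 / e₂ ^ 2))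
    (hD : ∀ x ∈ Ioo (0 : ℝ) e', HasDerivAt Λ (D x) x) {g : ℝ} (hg : g ∈ Ioc (0 : ℝ) e') :
    DifferentiableOn ℝ (fun σ : ℝ => invFunOn Λ (Ioc 0 e') (Λ g + σ * β₀)) (Ioi 0) := by
  intro s hs
  have he' : e' ∈ Ioc (0 : ℝ) e' := ⟨hg.1.trans_le hg.2, le_rfl⟩
  have hΛg : Λ e' ≤ Λ g := hanti.antitoneOn hg he' hg.2
  have hgs : Λ e' < Λ g + s * β₀ := by have := mul_pos (mem_Ioi.1 hs) hβ₀; linarith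
  exact (rg_hasDerivAt hanti honto hβ₀ hbounds hD hgs).differentiableAt.differentiableWithinAt

/-- **THE PIN DERIVATIVE AT EVERY SCALE**: for an interior pin g and `Λ e′ < Λ g + sβ₀`: **`∂_g φ_s g = D(g)∕D(φ_s g)`** — `∂g(s)∕∂g(0) = β_c(g(s))∕β_c(g(0))`. [folklore] -/
theorem rg_hasDerivAt_pin (hanti : StrictAntiOn Λ (Ioc 0 e')) (honto : ∀ y : ℝ, Λ e' ≤ y → ∃ x ∈ Ioc (0 : ℝ) e', Λ x = y) (hβ₀ : 0 < β₀)
    (hbounds : ∀ e₁ ∈ Ioc (0 : ℝ) e', ∀ e₂ ∈ Ioc (0 : ℝ) e', e₁ ≤ e₂ →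
      2 / 3 * (1 / e₁ ^ 2 - 1 / e₂ ^ 2) ≤ Λ e₁ - Λ e₂ ∧ Λ e₁ - Λ e₂ ≤ 4 / 3 * (1 / e₁ ^ 2 - 1 / e₂ ^ 2))
    (hD : ∀ x ∈ Ioo (0 : ℝ) e', HasDerivAt Λ (D x) x) {g s : ℝ} (hg : g ∈ Ioo (0 : ℝ) e') (hgs : Λ e' < Λ g + s * β₀) :
    HasDerivAt (fun g' : ℝ => invFunOn Λ (Ioc 0 e') (Λ g' + s * β₀)) (D g / D (invFunOn Λ (Ioc 0 e') (Λ g + s * β₀))) g := by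
  obtain ⟨hxmem, hΛx⟩ := rg_mem_eq_of_le honto hgs.le
  have hxlt : invFunOn Λ (Ioc 0 e') (Λ g + s * β₀) < e' := by
    rcases hxmem.2.lt_or_eq with h | h
    · exact h
    · exfalso; rw [h] at hΛx; linarith
  exact hasDerivAt_rg_pin hanti honto hβ₀ hbounds hgs (hD g hg) (hD _ ⟨hxmem.1, hxlt⟩)

/-- **THE LINEAR RENORMALIZATION-GROUP EQUATION AT EVERY POINT**: for an interior pin g and `Λ e′ < Λ g + sβ₀`, the scale derivative `β₀∕D(φ_s g)` and the pin
derivative `D(g)∕D(φ_s g)` of `φ_s g` satisfy **`∂_s φ = β_c(g)·∂_g φ`**, `β_c = β₀∕D` — the running coupling is constant along the characteristics of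
`∂_s − β_c(g)∂_g`. [folklore] -/
theorem rg_transport_everywhere (hanti : StrictAntiOn Λ (Ioc 0 e')) (honto : ∀ y : ℝ, Λ e' ≤ y → ∃ x ∈ Ioc (0 : ℝ) e', Λ x = y) (hβ₀ : 0 < β₀)
    (hbounds : ∀ e₁ ∈ Ioc (0 : ℝ) e', ∀ e₂ ∈ Ioc (0 : ℝ) e', e₁ ≤ e₂ →
      2 / 3 * (1 / e₁ ^ 2 - 1 / e₂ ^ 2) ≤ Λ e₁ - Λ e₂ ∧ Λ e₁ - Λ e₂ ≤ 4 / 3 * (1 / e₁ ^ 2 - 1 / e₂ ^ 2))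
    (hD : ∀ x ∈ Ioo (0 : ℝ) e', HasDerivAt Λ (D x) x) {g s : ℝ} (hg : g ∈ Ioo (0 : ℝ) e') (hgs : Λ e' < Λ g + s * β₀) :
    deriv (fun σ : ℝ => invFunOn Λ (Ioc 0 e') (Λ g + σ * β₀)) s
      = β₀ / D g * deriv (fun g' : ℝ => invFunOn Λ (Ioc 0 e') (Λ g' + s * β₀)) g := by
  rw [(rg_hasDerivAt hanti honto hβ₀ hbounds hD hgs).deriv, (rg_hasDerivAt_pin hanti honto hβ₀ hbounds hD hg hgs).deriv]
  have hDg : D g ≠ 0 := (generator_bounds hbounds hD hg).2.2.ne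
  field_simp

/-- **C¹ IN THE SCALE**: if moreover D is continuous on ]0, e′[, then for every `g ∈ ]0, e′]` the velocity `s ↦ β₀∕D(φ_s g)` is continuous on ]0, ∞[ — the running coupling
is continuously differentiable in the scale (part 51: `s ↦ φ_s g` is continuous; `φ_s g` is interior for `s > 0`). [folklore] -/
theorem rg_velocity_continuousOn (hanti : StrictAntiOn Λ (Ioc 0 e')) (honto : ∀ y : ℝ, Λ e' ≤ y → ∃ x ∈ Ioc (0 : ℝ) e', Λ x = y) (hβ₀ : 0 < β₀)
    (hbounds : ∀ e₁ ∈ Ioc (0 : ℝ) e', ∀ e₂ ∈ Ioc (0 : ℝ) e', e₁ ≤ e₂ →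
      2 / 3 * (1 / e₁ ^ 2 - 1 / e₂ ^ 2) ≤ Λ e₁ - Λ e₂ ∧ Λ e₁ - Λ e₂ ≤ 4 / 3 * (1 / e₁ ^ 2 - 1 / e₂ ^ 2))
    (hD : ∀ x ∈ Ioo (0 : ℝ) e', HasDerivAt Λ (D x) x) (hDc : ContinuousOn D (Ioo 0 e')) {g : ℝ} (hg : g ∈ Ioc (0 : ℝ) e') :
    ContinuousOn (fun s : ℝ => β₀ / D (invFunOn Λ (Ioc 0 e') (Λ g + s * β₀))) (Ioi 0) := by
  have he' : e' ∈ Ioc (0 : ℝ) e' := ⟨hg.1.trans_le hg.2, le_rfl⟩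
  have hΛg : Λ e' ≤ Λ g := hanti.antitoneOn hg he' hg.2
  have hφ : ContinuousOn (fun s : ℝ => invFunOn Λ (Ioc 0 e') (Λ g + s * β₀)) (Ioi 0) :=
    (rg_continuousOn hanti honto hβ₀ (fun e₁ h₁ e₂ h₂ h => (hbounds e₁ h₁ e₂ h₂ h).1) hg).mono Ioi_subset_Ici_self
  have hmaps : MapsTo (fun s : ℝ => invFunOn Λ (Ioc 0 e') (Λ g + s * β₀)) (Ioi 0) (Ioo 0 e') := by
    intro s hs
    have hgs : Λ e' < Λ g + s * β₀ := by have := mul_pos (mem_Ioi.1 hs) hβ₀; linarith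
    obtain ⟨hxmem, hΛx⟩ := rg_mem_eq_of_le honto hgs.le
    refine ⟨hxmem.1, ?_⟩
    rcases hxmem.2.lt_or_eq with h | h
    · exact h
    · exfalso; rw [h] at hΛx; linarith
  have hcomp : ContinuousOn (fun s : ℝ => D (invFunOn Λ (Ioc 0 e') (Λ g + s * β₀))) (Ioi 0) := hDc.comp hφ hmaps
  exact continuousOn_const.div hcomp fun s hs => (generator_bounds hbounds hD (hmaps hs)).2.2.ne

/-! ## §97 The integral form: `∫ D = ΔΛ` without integrability hypotheses, and RG time as `∫ dg∕|β_c|` -/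

/-- **`∫_{g₁}^{g₂} D = Λ g₂ − Λ g₁`** on every `[g₁, g₂] ⊆ ]0, e′[` — NO continuity or integrability hypothesis on D: Λ is absolutely continuous (part 59) and `deriv Λ = D` on the
interval. [folklore] -/
theorem integral_generator_eq (hbounds : ∀ e₁ ∈ Ioc (0 : ℝ) e', ∀ e₂ ∈ Ioc (0 : ℝ) e', e₁ ≤ e₂ →
      2 / 3 * (1 / e₁ ^ 2 - 1 / e₂ ^ 2) ≤ Λ e₁ - Λ e₂ ∧ Λ e₁ - Λ e₂ ≤ 4 / 3 * (1 / e₁ ^ 2 - 1 / e₂ ^ 2))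
    (hD : ∀ x ∈ Ioo (0 : ℝ) e', HasDerivAt Λ (D x) x) {g₁ g₂ : ℝ} (hg₁ : 0 < g₁) (h12 : g₁ ≤ g₂) (hg₂ : g₂ < e') :
    ∫ x in g₁..g₂, D x = Λ g₂ - Λ g₁ := by
  have hftc := abel_integral_deriv hbounds ⟨hg₁, h12.trans hg₂.le⟩ ⟨hg₁.trans_le h12, hg₂.le⟩ h12
  rw [← hftc]
  refine intervalIntegral.integral_congr fun x hx => ?_
  rw [uIcc_of_le h12] at hx
  exact ((hD x ⟨hg₁.trans_le hx.1, lt_of_le_of_lt hx.2 hg₂⟩).deriv).symm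

/-- **RG TIME IS `∫ dg∕|β_c(g)|` WITH THE CONTINUOUS GENERATOR**: for an interior pin g and `s ≥ 0`: **`s = ∫_{φ_s g}^{g} (−D x∕β₀) dx`**, `−D∕β₀ = 1∕|β_c|`. [folklore] -/
theorem rg_time_eq_integral_generator (hanti : StrictAntiOn Λ (Ioc 0 e')) (honto : ∀ y : ℝ, Λ e' ≤ y → ∃ x ∈ Ioc (0 : ℝ) e', Λ x = y) (hβ₀ : 0 < β₀)
    (hbounds : ∀ e₁ ∈ Ioc (0 : ℝ) e', ∀ e₂ ∈ Ioc (0 : ℝ) e', e₁ ≤ e₂ →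
      2 / 3 * (1 / e₁ ^ 2 - 1 / e₂ ^ 2) ≤ Λ e₁ - Λ e₂ ∧ Λ e₁ - Λ e₂ ≤ 4 / 3 * (1 / e₁ ^ 2 - 1 / e₂ ^ 2))
    (hD : ∀ x ∈ Ioo (0 : ℝ) e', HasDerivAt Λ (D x) x) {g s : ℝ} (hg : g ∈ Ioo (0 : ℝ) e') (hs : 0 ≤ s) :
    s = ∫ x in invFunOn Λ (Ioc 0 e') (Λ g + s * β₀)..g, -D x / β₀ := by
  have hgmem : g ∈ Ioc (0 : ℝ) e' := ⟨hg.1, hg.2.le⟩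
  obtain ⟨hxmem, hΛx⟩ := rg_mem_eq hanti honto hβ₀.le hgmem hs
  have hle : invFunOn Λ (Ioc 0 e') (Λ g + s * β₀) ≤ g := rg_le_self hanti honto hβ₀.le hgmem hs
  rw [intervalIntegral.integral_div, intervalIntegral.integral_neg, integral_generator_eq hbounds hD hxmem.1 hle hg.2, hΛx]
  field_simp
  ring

end

end Summit.QuantumFields.BalabanUV.Beta.EriceFlowEnclosureB12AsPrintedHistoryContagionShiftFlowZeroSemigroupGellMannLowSmooth
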